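import Summits.Ventures.HSemireg.WedgeHankelRecurrenceGaussChebyshevTMixedLevelIdeal

/-!
# Venture HSemireg — **THE LAW-OF-REPETITION SKELETON FOR `S`: `S_{mn−1} = S_{n−1} · S_{m−1}(C_n)` with `C_n − 2 ∣ S_{m−1}(C_n) − m`** (all `m, n ∈ ℤ`, every commutative ring; `S_{m−1}(2) = m`), and the
# integer reading for the Lucas pair with `Q = 1`: **`U_{mn} = U_n · w` with `w ≡ m (mod V_n − 2)`** — since `(V_n − 2)(V_n + 2) = D U_n²`, an odd prime `p ∣ U_n` with `p ∣ V_n − 2` and `p ∤ m`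
# does not divide the cofactor `w` (the valuation statements themselves live in `Literature…LucasSequences.LawOfRepetition*`, general `P, Q`, and are cited, not restated)

HONEST FRAMING. Part of the Lean index of the computation cell `pub-hsemireg` (seat p10 gen 48, Sunday typer «UNIFORM-IN-n»).  Polynomial ∕ integer algebra only; no variety, no cohomology theory, no
sheaf, no Ext group and no semiregularity map is constructed here; nothing here says that HC / HC_CM / HC_AV holds; no Literature fact (unproved `Prop`) is declared or used.  Custodian versions as
in `WedgeHankelSiegelIdeal` (1/3).
SOURCES (cited).  É. Lucas, Amer. J. Math. 1 (1878), §§VIII–IX; P. Ribenboim, *My Numbers, My Friends* (2000), Ch. 1 §IV ((IV.18)–(IV.20)); D. H. Lehmer, Ann. of Math. 31 (1930) 419–448, §2.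
PROOF TYPED HERE.  N487 `chebyshevS_mul_pred_eq_comp`; N488 `chebyshev_sub_C_dvd_comp_sub_C`; Mathlib `S_eval_two`; N483 `lucasU_one_eq_chebyshevS_eval`; N476 `lucasV_one_eq_chebyshevC_eval`.
DEDUP DISCLOSURE (`rg -n 'chebyshevC_sub_two_dvd_S_comp_sub|lucasU_one_mul_eq|chebyshevS_mul_pred_cofactor' Summits Literature HarnessLib`, 2026-09-04): `Literature…LucasSequences.Subsequences` (`U_n ∣ U_{kn}`),
`LawOfRepetition*` (valuations) — integer statements, general `P, Q`; the polynomial congruence below is not there; 0 hits for the 2 names below.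

WHAT IS IN THE TREE.  N476, N483, N487, N488, N493.
THIS FILE (namespace `Summit.Ventures.HSemireg.Wedge.HankelOuter` continued; CHAINED on N498; 0 definitions):
* §1264 **`chebyshevC_sub_two_dvd_S_comp_sub`**, **`lucasU_one_mul_eq`**.
CAVEATS.  `Q = 1`; no valuation statement typed.  Nothing Ext-side.  New names only.
-/

open Module Polynomial
open scoped Matrix Polynomial

namespace Summit.Ventures.HSemireg.Wedge.HankelOuter

/-! ## §1264. `C_n − 2 ∣ S_{m−1}(C_n) − m` -/

/-- **`C_n − 2 ∣ S_{m−1}(C_n) − m`** for all `m, n ∈ ℤ` in every commutative ring (`S_{m−1}(2) = m`). [Ribenboim Ch. 1 §IV; this file, §1264] -/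
theorem chebyshevC_sub_two_dvd_S_comp_sub {R : Type*} [CommRing R] (m n : ℤ) :
    Polynomial.Chebyshev.C R n - 2 ∣ (Polynomial.Chebyshev.S R (m - 1)).comp (Polynomial.Chebyshev.C R n) - (m : R[X]) := by
  have h := chebyshev_sub_C_dvd_comp_sub_C (Polynomial.Chebyshev.S R (m - 1)) (Polynomial.Chebyshev.C R n) 2
  rwa [Polynomial.Chebyshev.S_eval_two, Int.cast_sub, Int.cast_one, sub_add_cancel, Polynomial.C_ofNat, map_intCast] at h

/-- **`U_{mn} = U_n · w` with `w ≡ m (mod V_n − 2)`** for the Lucas pair `U_0 = 0, U_1 = 1`, `V_0 = 2, V_1 = P`, `x_{k+2} = P x_{k+1} − x_k` over `ℤ` (`w = S_{m−1}(V_n)`). [Lucas 1878; Ribenboim (IV.18)–(IV.20);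
this file, §1264] -/
theorem lucasU_one_mul_eq {P : ℤ} {U V : ℕ → ℤ} (hU0 : U 0 = 0) (hU1 : U 1 = 1) (hU : ∀ n, U (n + 2) = P * U (n + 1) - U n)
    (hV0 : V 0 = 2) (hV1 : V 1 = P) (hV : ∀ n, V (n + 2) = P * V (n + 1) - V n) (m n : ℕ) :
    ∃ w : ℤ, U (m * n) = U n * w ∧ V n - 2 ∣ w - m := by
  refine ⟨(Polynomial.Chebyshev.S ℤ ((m : ℤ) - 1)).eval (V n), ?_, ?_⟩
  · rw [lucasU_one_eq_chebyshevS_eval hU0 hU1 hU (m * n), lucasU_one_eq_chebyshevS_eval hU0 hU1 hU n, lucasV_one_eq_chebyshevC_eval hV0 hV1 hV n, Nat.cast_mul,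
      chebyshevS_mul_pred_eq_comp, eval_mul, eval_comp, mul_comm]
  · obtain ⟨c, hc⟩ := chebyshevC_sub_two_dvd_S_comp_sub (R := ℤ) (m : ℤ) (n : ℤ)
    refine ⟨c.eval P, ?_⟩
    have h := congrArg (Polynomial.eval P) hc
    rw [eval_sub, eval_comp, eval_intCast, Int.cast_id, eval_mul, eval_sub, eval_ofNat, ← lucasV_one_eq_chebyshevC_eval hV0 hV1 hV n] at h
    exact h

end Summit.Ventures.HSemireg.Wedge.HankelOuter
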